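import Summits.AtomisticToContinuum.Crystallization.Theses.GappedShellCensus

/-!
# Stub `stub_tfCircleTwo` — closed half-plane for two vectors
# (crux `GappedShellCensus.TornFree`, line `Sketch`)

Two vectors `q 0, q 1` of `ℝ³` orthogonal to a fixed `b ≠ 0` lie in a closed half-plane of the
plane `bᗮ`: there is a unit direction `e ⊥ b` with `⟪q i, e⟫ ≤ 0` for `i = 0, 1`.

The proof is trigonometry-free.  An orthonormal pair `(u, v)` in the plane `bᗮ`
(`tfCircleTwo_frame`, from `stdOrthonormalBasis` on `(ℝ ∙ b)ᗮ`) turns the statement about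
`e = α • u + β • v` into real arithmetic on the planar coordinates
`(x i, y i) = (⟪q i, u⟫, ⟪q i, v⟫)`: some unit `(α, β)` has `α * x i + β * y i ≤ 0` for both `i`
(`tfCircleTwo_real`).  Planar proof (`tfCircleTwo_half`): if `(x 0, y 0) ≠ 0`, the direction
`(-y 0, x 0)` is orthogonal to `(x 0, y 0)`, and one of `±(-y 0, x 0)` is weakly opposite to
`(x 1, y 1)`; if `(x 0, y 0) = 0` the roles are swapped, and if both vanish any unit direction
works.  The normalisation of a nonzero direction to a unit one is `tfCircleTwo_unit`.

The hypothesis `⟪q i, b⟫ = 0` of the registered signature is not used by the proof (for `e ⊥ b`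
the inner product `⟪q i, e⟫` only sees the component of `q i` in `bᗮ`); the statement is kept
exactly as registered in the skeleton.
-/

noncomputable section

namespace Summit.AtomisticToContinuum.Crystallization.Theorems

open scoped RealInnerProductSpace

/-- Normalisation: a nonzero planar direction `(d₁, d₂)` weakly opposite to the two planar vectors
`(a₀, b₀)` and `(a₁, b₁)` rescales to a unit direction with the same property. -/
private theorem tfCircleTwo_unit {d₁ d₂ a₀ b₀ a₁ b₁ : ℝ} (hd : d₁ ^ 2 + d₂ ^ 2 ≠ 0)
    (h₀ : d₁ * a₀ + d₂ * b₀ ≤ 0) (h₁ : d₁ * a₁ + d₂ * b₁ ≤ 0) :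
    ∃ α β : ℝ, α ^ 2 + β ^ 2 = 1 ∧ α * a₀ + β * b₀ ≤ 0 ∧ α * a₁ + β * b₁ ≤ 0 := by
  have hpos : 0 < d₁ ^ 2 + d₂ ^ 2 := lt_of_le_of_ne (by positivity) (Ne.symm hd)
  obtain ⟨r, hr, hrr⟩ : ∃ r : ℝ, 0 < r ∧ r ^ 2 = d₁ ^ 2 + d₂ ^ 2 :=
    ⟨Real.sqrt (d₁ ^ 2 + d₂ ^ 2), Real.sqrt_pos.mpr hpos, Real.sq_sqrt hpos.le⟩
  refine ⟨d₁ / r, d₂ / r, ?_, ?_, ?_⟩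
  · rw [div_pow, div_pow, ← add_div, ← hrr, div_self (pow_ne_zero 2 hr.ne')]
  · rw [div_mul_eq_mul_div, div_mul_eq_mul_div, ← add_div]
    exact div_nonpos_of_nonpos_of_nonneg h₀ hr.le
  · rw [div_mul_eq_mul_div, div_mul_eq_mul_div, ← add_div]
    exact div_nonpos_of_nonpos_of_nonneg h₁ hr.le

/-- Closed half-plane for two planar vectors `(a₀, b₀) ≠ 0` and `(a₁, b₁)`: one of the two unit
directions `± (-b₀, a₀) / ‖(a₀, b₀)‖` orthogonal to `(a₀, b₀)` is weakly opposite to `(a₁, b₁)`. -/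
private theorem tfCircleTwo_half {a₀ b₀ : ℝ} (a₁ b₁ : ℝ) (h : a₀ ^ 2 + b₀ ^ 2 ≠ 0) :
    ∃ α β : ℝ, α ^ 2 + β ^ 2 = 1 ∧ α * a₀ + β * b₀ ≤ 0 ∧ α * a₁ + β * b₁ ≤ 0 := by
  rcases le_or_gt (-b₀ * a₁ + a₀ * b₁) 0 with h₁ | h₁
  · exact tfCircleTwo_unit (d₁ := -b₀) (d₂ := a₀) (by rwa [neg_sq, add_comm]) (le_of_eq (by ring))
      h₁
  · exact tfCircleTwo_unit (d₁ := b₀) (d₂ := -a₀) (by rwa [neg_sq, add_comm]) (le_of_eq (by ring))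
      (by linarith)

/-- Closed half-plane in coordinates: for two planar vectors `(x i, y i)`, `i : Fin 2`, there is a
unit direction `(α, β)` weakly opposite to both, `α * x i + β * y i ≤ 0`. -/
private theorem tfCircleTwo_real (x y : Fin 2 → ℝ) :
    ∃ α β : ℝ, α ^ 2 + β ^ 2 = 1 ∧ ∀ i, α * x i + β * y i ≤ 0 := by
  simp only [Fin.forall_fin_two]
  by_cases h0 : x 0 ^ 2 + y 0 ^ 2 = 0
  · by_cases h1 : x 1 ^ 2 + y 1 ^ 2 = 0
    · -- both vectors vanish: any unit direction works
      have hx0 : x 0 = 0 := sq_eq_zero_iff.mp (by linarith [sq_nonneg (x 0), sq_nonneg (y 0)])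
      have hx1 : x 1 = 0 := sq_eq_zero_iff.mp (by linarith [sq_nonneg (x 1), sq_nonneg (y 1)])
      exact ⟨1, 0, by norm_num, by linarith, by linarith⟩
    · -- `(x 0, y 0) = 0 ≠ (x 1, y 1)`: swap the roles
      obtain ⟨α, β, hab, h1', h0'⟩ := tfCircleTwo_half (x 0) (y 0) h1
      exact ⟨α, β, hab, h0', h1'⟩
  · exact tfCircleTwo_half (x 1) (y 1) h0

-- adapted from `tfCircleThree_frame` (Theorems/GappedShellCensusTornFreeStubTfCircleThree.lean)
/-- An orthonormal pair `(u, v)` in the plane `bᗮ ⊆ ℝ³` (`b ≠ 0`), read off from an orthonormal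
basis of the `2`-dimensional subspace `(ℝ ∙ b)ᗮ`. -/
private theorem tfCircleTwo_frame (b : EuclideanSpace ℝ (Fin 3)) (hb : b ≠ 0) :
    ∃ u v : EuclideanSpace ℝ (Fin 3), ‖u‖ = 1 ∧ ‖v‖ = 1 ∧ ⟪u, v⟫ = 0 ∧ ⟪u, b⟫ = 0 ∧
      ⟪v, b⟫ = 0 := by
  haveI : Fact (Module.finrank ℝ (EuclideanSpace ℝ (Fin 3)) = 2 + 1) := ⟨by simp⟩
  have hK : Module.finrank ℝ (ℝ ∙ b)ᗮ = 2 := Submodule.finrank_orthogonal_span_singleton hb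
  let ob : OrthonormalBasis (Fin 2) ℝ (ℝ ∙ b)ᗮ :=
    (stdOrthonormalBasis ℝ (ℝ ∙ b)ᗮ).reindex (finCongr hK)
  refine ⟨(ob 0 : EuclideanSpace ℝ (Fin 3)), (ob 1 : EuclideanSpace ℝ (Fin 3)), ?_, ?_, ?_, ?_,
    ?_⟩
  · rw [Submodule.norm_coe]; exact ob.norm_eq_one 0
  · rw [Submodule.norm_coe]; exact ob.norm_eq_one 1
  · rw [← Submodule.coe_inner]; exact ob.inner_eq_zero (by decide)
  · exact Submodule.mem_orthogonal_singleton_iff_inner_left.mp (ob 0).2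
  · exact Submodule.mem_orthogonal_singleton_iff_inner_left.mp (ob 1).2

/-- **Stub (closed half-plane for two vectors).** Two vectors orthogonal to `b ≠ 0` lie in a closed
half-plane of `bᗮ`: there is a unit `e ⊥ b` with `⟪q i, e⟫ ≤ 0` for both.  (The orthogonality
hypothesis on the `q i` is part of the registered signature but not needed.) [folklore] -/
theorem stub_tfCircleTwo :
    ∀ b : EuclideanSpace ℝ (Fin 3), b ≠ 0 → ∀ q : Fin 2 → EuclideanSpace ℝ (Fin 3),
      (∀ i, ⟪q i, b⟫ = 0) →
      ∃ e : EuclideanSpace ℝ (Fin 3), ‖e‖ = 1 ∧ ⟪e, b⟫ = 0 ∧ ∀ i, ⟪q i, e⟫ ≤ 0 := by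
  intro b hb q _
  obtain ⟨u, v, hu, hv, huv, hub, hvb⟩ := tfCircleTwo_frame b hb
  obtain ⟨α, β, hab, h⟩ := tfCircleTwo_real (fun i => ⟪q i, u⟫) (fun i => ⟪q i, v⟫)
  have hvu : ⟪v, u⟫ = 0 := by rw [real_inner_comm]; exact huv
  refine ⟨α • u + β • v, ?_, ?_, fun i => ?_⟩
  · have hn : ⟪α • u + β • v, α • u + β • v⟫ = α ^ 2 + β ^ 2 := by
      simp only [inner_add_left, inner_add_right, real_inner_smul_left, real_inner_smul_right]
      rw [real_inner_self_eq_norm_sq, real_inner_self_eq_norm_sq, hu, hv, huv, hvu]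
      ring
    rw [norm_eq_sqrt_real_inner, hn, hab, Real.sqrt_one]
  · rw [inner_add_left, real_inner_smul_left, real_inner_smul_left, hub, hvb, mul_zero, mul_zero,
      add_zero]
  · have hi : α * ⟪q i, u⟫ + β * ⟪q i, v⟫ ≤ 0 := h i
    rw [inner_add_right, real_inner_smul_right, real_inner_smul_right]
    exact hi

end Summit.AtomisticToContinuum.Crystallization.Theorems

end
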